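import Summits.BirchSwinnertonDyer.BirchSwinnertonDyer.Theorems.KimAtThreeDeepLowerExpStarOmegaLine
import Summits.BirchSwinnertonDyer.BirchSwinnertonDyer.Theorems.KimAtThreeDeepLeafOfDefinedKatoUniform
import HarnessLib

/-!
# The W2 deep leaf with `φ = exp*_ω` DEFINED: (C1_ω) ⟹ (C1ₑₓ) ⟹ `DeepLowerAtThree` (19075),
# `DeepLowerAtThreeOffKatoStratum` (19679), `DeepUpperAtThree` (19076), `DeepUpperAtThreeOffKatoStratum` (19562)
# and `N11.KimAtThreeDeepPUB` BY NAME (route `KimAtThreeKolyvagin`, rung W2; cell `bsd-addord`, seat w2-c2 gen 8)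

HONEST FRAMING: glue with DISPLAYED hypotheses (no definition, no named fact, no `sorry`); the conclusions are route
decls BY NAME but CONDITIONAL on the displayed package (C1_ω), the four cite-only leaves and the construction statement
`PAdicHodge.nonempty_neronDeRhamDatum`; NOTHING is closed and nothing is booked; BSD is not proved by any of this.

## What, and why
w2-c3 g7's `KimAtThreeDeepLeafOfDefinedKatoUniform` (p496891) reduces all five deep decls of W2 to the route's four
leaves and ONE package (C1ₑₓ) (`KimAtThreeDeepUpperOfDefinedKatoUniform`, p494680), which quantifies over an ABSTRACT
additive functional `φ : (tateLocalRep W 3 (Sum.inr v₃)).cohomology 1 →+ ℚ_[3]` «= exp*_ω at ℚ₃».  This seat's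
`KimAtThreeDeepLowerExpStarOmega[Place]` (p500247, p501298) DEFINE that functional — Kato LNM 1553 II.1.2.4 `exp*` for
Fontaine's `B_dR(ℚ_{v₃})` along a Néron line `d` — and `KimAtThreeDeepLowerExpStarOmegaLine` supplies a line datum at
every `v ∣ p` from `nonempty_neronDeRhamDatum`.  This file SUBSTITUTES the definition for the variable:

* **(C1_ω)** (`hω`, displayed) = the text of (C1ₑₓ) VERBATIM with `φ := expStarOmegaPadicAt (d.smul e he) hinj hex ιp`
  for EVERY line datum `d : LocalNeronLineAt W 3 v₃`, the remaining data `hinj` / `hex` (the two halves of Kato's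
  Prop. 1.2.3 for `V_3W` over `ℚ_{v₃}`), `ιp : ℚ_{v₃} →+* ℚ_3`, the scaling unit `e ≠ 0` (the Néron normalisation of
  the scale-free datum — `hdual` pins it), Kato's `ι`, `κK`, `Λ` being existential.  Every clause of (C1_ω) is now a
  statement about DEFINED objects: `hker` = [BK90] Prop. 3.8 / Ex. 3.11 and `hdual` = Tate duality for `exp*_ω` (the
  (S5a)/(S5b) cite items, w2-c3 g8), X1-int_b ⟸ (DEF)+(RES)+(LAT_b) (acc5 / acc3), `ZetaBody` ⟸ Kato-v2.
* `definedKatoUniform_of_expStarOmega : nonempty_neronDeRhamDatum → (C1_ω) → (C1ₑₓ)` (∃-introduction at the line datum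
  supplied by `nonempty_localNeronLineAt_of_nonempty_neronDeRhamDatum`);
* the five deep decls and `N11.KimAtThreeDeepPUB` BY NAME from {4 leaves} ∧ `nonempty_neronDeRhamDatum` ∧ (C1_ω)
  (one line each through p496891).

References: [Kato1993LNM1553] Ch. II §1.2.4, Prop. 1.2.3, Ex. 1.3.5; [BlochKato1990] §3 (Prop. 3.8, Ex. 3.11);
[Kato2004Asterisque] (8.1.3), §9.4, Thm. 9.7, Ex. 13.3; [Kim2022StructureSelmer] Thm. 3.13; [Kim2025RefinedTNC] Thm 1.1;
[MazurRubin2004] Thm. 5.2.12, App. A Prop. A.2; [Sakamoto2024] Thm. 4.4; [MilneADT2006] I.4.10; [Carayol1986].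
-/

set_option autoImplicit false
-- the Theorems namespace of a single-conjunct summit repeats the summit name by design (D-0017)
set_option linter.dupNamespace false

noncomputable section

open scoped NumberField TensorProduct ContRepresentation Classical
open CategoryTheory Field Function Finset IsDedekindDomain NumberField WeierstrassCurve
open Rat.HeightOneSpectrum
open Literature.NumberTheory.GaloisRepresentations Literature.NumberTheory.GaloisCohomology
open Literature.NumberTheory.GaloisRepresentations.DiscreteGaloisModule
open Literature.NumberTheory.GaloisRepresentations.PeriodRingData
open Literature.NumberTheory.PAdicHodge
open Literature.NumberTheory.EllipticCurves Literature.NumberTheory.EllipticCurves.ModularForms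
open Literature.NumberTheory.EllipticCurves.Rank1Residual
open Literature.NumberTheory.EllipticCurves.Kato2004
open Literature.NumberTheory.EllipticCurves.Kato2004.EulerSystemValues
open Summit.BirchSwinnertonDyer.Rank1Residual.GaloisImage
open Summit.BirchSwinnertonDyer.Rank1Residual.Additive
open Summit.BirchSwinnertonDyer.Rank1Residual.Additive.LocalLog
open Summit.BirchSwinnertonDyer.BirchSwinnertonDyer.Theses.KimAtThreeKolyvagin
open Summit.BirchSwinnertonDyer.BirchSwinnertonDyer.Theorems.KimAtThreeKolyvaginDefs
open Summit.BirchSwinnertonDyer.BirchSwinnertonDyer.Theorems.KimAtThreeDeepLowerExpStarOmega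
open Summit.BirchSwinnertonDyer.BirchSwinnertonDyer.Theorems.KimAtThreeDeepLowerExpStarOmegaPlace
open Summit.BirchSwinnertonDyer.BirchSwinnertonDyer.Theorems.KimAtThreeDeepLowerExpStarOmegaLine
open Summit.BirchSwinnertonDyer.BirchSwinnertonDyer.Theorems.KimAtThreeDeepLeafOfDefinedKatoUniform

namespace Summit.BirchSwinnertonDyer.BirchSwinnertonDyer.Theorems.KimAtThreeDeepLowerExpStarOmegaBridge

attribute [local instance] valuativeRelPlace topologicalSpacePlace isNonarchimedeanLocalField_place
  charZero_place padicAlgebraPlace fact_not_isUnit_place isAdicComplete_place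

section Bridge

variable
  -- (C1_ω): the defined-Kato package (C1ₑₓ) with `φ := exp*_ω` DEFINED, for every Néron line datum `d`
  (hω : ∀ (W : WeierstrassCurve ℚ) [W.IsElliptic] [W.IsGloballyMinimal]
        [ContinuousSMul ℤ_[3] (W.tateModule 3)] [Module.Free ℤ_[3] (W.tateModule 3)]
        [Module.Finite ℤ_[3] (W.tateModule 3)],
        (∀ m : ℕ, W.HasSurjectiveModNGaloisRep (3 ^ m : ℕ)) →
        ∀ (v₃ : HeightOneSpectrum (𝓞 ℚ)) (hv₃ : ((3 : ℕ) : 𝓞 ℚ) ∈ v₃.asIdeal),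
        ∀ {N : ℕ} [NeZero N] (P : ModularParametrizationData W N), N = W.conductorNorm ℤ →
          (∀ z ∈ P.L.lattice, ∃ w ∈ periodLattice P.f, z = P.c * w) →
          (haveI : Fact (((3 : ℕ) : 𝓞 ℚ) ∈ v₃.asIdeal) := ⟨hv₃⟩
          ∀ d : LocalNeronLineAt W 3 v₃,
          ∃ (hinj : (bdRPeriodRingData (valuation_place_lt_one 3 v₃)).CupLogInjective (logCyclotomic 3)
              (localRationalTateRep W 3 (galRestrictPlace v₃)))
            (hex : ∀ z : contOneCocycles (localRationalTateRep W 3 (galRestrictPlace v₃)).toTopRep,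
              (bdRPeriodRingData (valuation_place_lt_one 3 v₃)).HasDualExp (logCyclotomic 3)
                (localRationalTateRep W 3 (galRestrictPlace v₃)) fun σ => z.1 σ)
            (ιp : Place.Completion (Sum.inr v₃ : Place ℚ) →+* ℚ_[3])
            (e : Place.Completion (Sum.inr v₃ : Place ℚ)) (he : e ≠ 0)
            (ι : (n : ℕ) → (CyclotomicField n ℚ →+* ℂ)) (κK : ℝ)
            (Λ : ∀ (k' : ℕ) (r : Finset (HeightOneSpectrum (𝓞 ℚ))),
              H1 (tateRep W 3) (cycSubgroup 3 k' r) →ₗ[ℤ_[3]] ℚ_[3] ⊗[ℚ] CyclotomicField (cycLevel 3 k' r) ℚ),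
            κK ≠ 0 ∧
            -- hker: [BK90] Prop. 3.8 / Ex. 3.11 in lattice form (kernel of `exp*_ω` = `H¹_f = E(ℚ₃) ⊗ ℤ₃`)
            (∀ y, expStarOmegaPadicAt (d.smul e he) hinj hex ιp y = 0 ↔ ∀ j : ℕ, tateLocalMap W 3 j (Sum.inr v₃) y ∈
              W.kummerSelmerStructure (((3 : ℕ) : ℤ) ^ j * ((3 : ℕ) : ℤ)) (Sum.inr v₃)) ∧
            -- hdual: Tate local duality + [BK90] 3.8 in lattice form (`exp*_ω(H¹) = (log_ω E(ℚ₃))^∨`)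
            (∀ a : ℚ_[3], (∃ y, expStarOmegaPadicAt (d.smul e he) hinj hex ιp y = a) ↔
              ∀ Q : (W.baseChange ℚ_[3]).toAffine.Point, ‖a * padicLog (W.baseChange ℚ_[3]) Q‖ ≤ 1) ∧
            -- (X1-int_b): `Λ_{0,r}` agrees with `φ` modulo `3^{j+1-b}·L_int` on restriction-compatible classes
            (∃ b : ℕ, ∀ (j : ℕ) (r : Finset (HeightOneSpectrum (𝓞 ℚ)))
              (Ψ : H1 (tateRep W 3) (cycSubgroup 3 0 r) →+
                continuousCohomology 1 (subgroupRep
                  (W.torsionGaloisModule (((3 : ℕ) : ℤ) ^ j * ((3 : ℕ) : ℤ))).toTopRep (cycSubgroup 3 0 r))),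
              (∀ (φ₁ : contOneCocycles (subgroupRep (tateRep W 3).toTopRep (cycSubgroup 3 0 r)))
                  (ψ : contOneCocycles (subgroupRep
                    (W.torsionGaloisModule (((3 : ℕ) : ℤ) ^ j * ((3 : ℕ) : ℤ))).toTopRep (cycSubgroup 3 0 r))),
                  (∀ g, ((ψ.1 g : geomTorsion W (((3 : ℕ) : ℤ) ^ j * ((3 : ℕ) : ℤ))) : geomPoints W) =
                    TateModule.proj 3 (j + 1) (φ₁.1 g)) →
                  Ψ (oneCocycleClass _ φ₁) = oneCocycleClass _ ψ) →
              ∀ (y : H1 (tateRep W 3) (cycSubgroup 3 0 r))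
                (κ₀ : galoisCohomology (W.torsionGaloisModule (((3 : ℕ) : ℤ) ^ j * ((3 : ℕ) : ℤ))) 1)
                (h : (tateLocalRep W 3 (Sum.inr v₃)).cohomology 1),
                resSubgroup (W.torsionGaloisModule (((3 : ℕ) : ℤ) ^ j * ((3 : ℕ) : ℤ))).toTopRep
                    (cycSubgroup 3 0 r) 1 κ₀ = Ψ y →
                galoisCohomology.localization (W.torsionGaloisModule (((3 : ℕ) : ℤ) ^ j * ((3 : ℕ) : ℤ)))
                    (Sum.inr v₃) 1 κ₀ = tateLocalMap W 3 j (Sum.inr v₃) h →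
                ∃ l ∈ cycIntLattice 3 (cycLevel 3 0 r),
                  (((3 : ℕ) : ℤ_[3]) ^ b) • ((expStarOmegaPadicAt (d.smul e he) hinj hex ιp h ⊗ₜ[ℚ] (1 : CyclotomicField (cycLevel 3 0 r) ℚ)) - Λ 0 r y) =
                    (((3 : ℕ) : ℤ_[3]) ^ (j + 1)) • (l : _)) ∧
            -- Kato's Euler system with its values in the coordinate `Λ`
            ∀ (c d a : ℤ) (A : ℕ), 0 < A → Int.gcd c (6 * 3 * A) = 1 → Int.gcd d (6 * 3 * N) = 1 →
              ∃ (z : ∀ (k' : ℕ) (r : (cyclotomicLevelsRat 3 (badPlaces c d A N)).Ideals),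
                    H1 (tateRep W 3) ((cyclotomicLevelsRat 3 (badPlaces c d A N)).level k' r.1))
                (x : ∀ (k' : ℕ) (r : (cyclotomicLevelsRat 3 (badPlaces c d A N)).Ideals),
                    CyclotomicField (cycLevel 3 k' r.1) ℚ),
                ZetaBody W 3 P.f ι κK Λ c d a A z x))

include hω

/-- **(C1_ω) ⟹ (C1ₑₓ)**: at each row take the line datum `d : LocalNeronLineAt W 3 v₃` supplied by
`PAdicHodge.nonempty_neronDeRhamDatum` (`nonempty_localNeronLineAt_of_nonempty_neronDeRhamDatum`) and instantiate
(C1ₑₓ)'s abstract `φ` at `expStarOmegaPadicAt (d.smul e he) hinj hex ιp`; the conclusion is w2-c3 g7's (C1ₑₓ) text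
VERBATIM (the `hKU` hypothesis of `KimAtThreeDeepUpperOfDefinedKatoUniform` / `KimAtThreeDeepLeafOfDefinedKatoUniform`).
[cite: Kato1993LNM1553, Ch. II §1.2.4 and Ex. 1.3.5] [cite: BlochKato1990, §3 (Prop. 3.8, Ex. 3.11)]
[cite: Kato2004Asterisque, (8.1.3), §9.4, Thm. 9.7 and Ex. 13.3] -/
theorem definedKatoUniform_of_expStarOmega (hND : nonempty_neronDeRhamDatum) :
    ∀ (W : WeierstrassCurve ℚ) [W.IsElliptic] [W.IsGloballyMinimal]
        [ContinuousSMul ℤ_[3] (W.tateModule 3)] [Module.Free ℤ_[3] (W.tateModule 3)]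
        [Module.Finite ℤ_[3] (W.tateModule 3)],
        (∀ m : ℕ, W.HasSurjectiveModNGaloisRep (3 ^ m : ℕ)) →
        ∀ (v₃ : HeightOneSpectrum (𝓞 ℚ)), ((3 : ℕ) : 𝓞 ℚ) ∈ v₃.asIdeal →
        ∀ {N : ℕ} [NeZero N] (P : ModularParametrizationData W N), N = W.conductorNorm ℤ →
          (∀ z ∈ P.L.lattice, ∃ w ∈ periodLattice P.f, z = P.c * w) →
          ∃ (ι : (n : ℕ) → (CyclotomicField n ℚ →+* ℂ)) (κK : ℝ)
            (Λ : ∀ (k' : ℕ) (r : Finset (HeightOneSpectrum (𝓞 ℚ))),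
              H1 (tateRep W 3) (cycSubgroup 3 k' r) →ₗ[ℤ_[3]] ℚ_[3] ⊗[ℚ] CyclotomicField (cycLevel 3 k' r) ℚ)
            (φ : (tateLocalRep W 3 (Sum.inr v₃)).cohomology 1 →+ ℚ_[3]),
            κK ≠ 0 ∧
            -- hker: [BK90] Prop. 3.8 / Ex. 3.11 in lattice form (kernel of `exp*_ω` = `H¹_f = E(ℚ₃) ⊗ ℤ₃`)
            (∀ y, φ y = 0 ↔ ∀ j : ℕ, tateLocalMap W 3 j (Sum.inr v₃) y ∈
              W.kummerSelmerStructure (((3 : ℕ) : ℤ) ^ j * ((3 : ℕ) : ℤ)) (Sum.inr v₃)) ∧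
            -- hdual: Tate local duality + [BK90] 3.8 in lattice form (`exp*_ω(H¹) = (log_ω E(ℚ₃))^∨`)
            (∀ a : ℚ_[3], (∃ y, φ y = a) ↔
              ∀ Q : (W.baseChange ℚ_[3]).toAffine.Point, ‖a * padicLog (W.baseChange ℚ_[3]) Q‖ ≤ 1) ∧
            -- (X1-int_b): `Λ_{0,r}` agrees with `φ` modulo `3^{j+1-b}·L_int` on restriction-compatible classes
            (∃ b : ℕ, ∀ (j : ℕ) (r : Finset (HeightOneSpectrum (𝓞 ℚ)))
              (Ψ : H1 (tateRep W 3) (cycSubgroup 3 0 r) →+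
                continuousCohomology 1 (subgroupRep
                  (W.torsionGaloisModule (((3 : ℕ) : ℤ) ^ j * ((3 : ℕ) : ℤ))).toTopRep (cycSubgroup 3 0 r))),
              (∀ (φ₁ : contOneCocycles (subgroupRep (tateRep W 3).toTopRep (cycSubgroup 3 0 r)))
                  (ψ : contOneCocycles (subgroupRep
                    (W.torsionGaloisModule (((3 : ℕ) : ℤ) ^ j * ((3 : ℕ) : ℤ))).toTopRep (cycSubgroup 3 0 r))),
                  (∀ g, ((ψ.1 g : geomTorsion W (((3 : ℕ) : ℤ) ^ j * ((3 : ℕ) : ℤ))) : geomPoints W) =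
                    TateModule.proj 3 (j + 1) (φ₁.1 g)) →
                  Ψ (oneCocycleClass _ φ₁) = oneCocycleClass _ ψ) →
              ∀ (y : H1 (tateRep W 3) (cycSubgroup 3 0 r))
                (κ₀ : galoisCohomology (W.torsionGaloisModule (((3 : ℕ) : ℤ) ^ j * ((3 : ℕ) : ℤ))) 1)
                (h : (tateLocalRep W 3 (Sum.inr v₃)).cohomology 1),
                resSubgroup (W.torsionGaloisModule (((3 : ℕ) : ℤ) ^ j * ((3 : ℕ) : ℤ))).toTopRep
                    (cycSubgroup 3 0 r) 1 κ₀ = Ψ y →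
                galoisCohomology.localization (W.torsionGaloisModule (((3 : ℕ) : ℤ) ^ j * ((3 : ℕ) : ℤ)))
                    (Sum.inr v₃) 1 κ₀ = tateLocalMap W 3 j (Sum.inr v₃) h →
                ∃ l ∈ cycIntLattice 3 (cycLevel 3 0 r),
                  (((3 : ℕ) : ℤ_[3]) ^ b) • ((φ h ⊗ₜ[ℚ] (1 : CyclotomicField (cycLevel 3 0 r) ℚ)) - Λ 0 r y) =
                    (((3 : ℕ) : ℤ_[3]) ^ (j + 1)) • (l : _)) ∧
            -- Kato's Euler system with its values in the coordinate `Λ`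
            ∀ (c d a : ℤ) (A : ℕ), 0 < A → Int.gcd c (6 * 3 * A) = 1 → Int.gcd d (6 * 3 * N) = 1 →
              ∃ (z : ∀ (k' : ℕ) (r : (cyclotomicLevelsRat 3 (badPlaces c d A N)).Ideals),
                    H1 (tateRep W 3) ((cyclotomicLevelsRat 3 (badPlaces c d A N)).level k' r.1))
                (x : ∀ (k' : ℕ) (r : (cyclotomicLevelsRat 3 (badPlaces c d A N)).Ideals),
                    CyclotomicField (cycLevel 3 k' r.1) ℚ),
                ZetaBody W 3 P.f ι κK Λ c d a A z x := by
  intro W _ _ _ _ _ htow v₃ hv₃ N _ P hN hlat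
  haveI : Fact (((3 : ℕ) : 𝓞 ℚ) ∈ v₃.asIdeal) := ⟨hv₃⟩
  obtain ⟨d⟩ := nonempty_localNeronLineAt_of_nonempty_neronDeRhamDatum W 3 v₃ hND
  obtain ⟨hinj, hex, ιp, e, he, ι, κK, Λ, hκ0, hker, hdual, hcompat, hZ⟩ := hω W htow v₃ hv₃ P hN hlat d
  exact ⟨ι, κK, Λ, expStarOmegaPadicAt (d.smul e he) hinj hex ιp, hκ0, hker, hdual, hcompat, hZ⟩

/-- **Crux `DeepLowerAtThree` (stmt-BirchSwinnertonDyer-19075) BY NAME** from the route's four cite-only leaves, the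
construction statement `nonempty_neronDeRhamDatum` and (C1_ω) (w2-c3 g7's `deepLowerAtThree_of_leaves_of_definedKatoUniform`
on `definedKatoUniform_of_expStarOmega`).  Conditional; nothing is booked.
[cite: Kim2025RefinedTNC, Thm 1.1] [cite: Sakamoto2024, Thm. 4.4 (1)(2) (p. 926)] [cite: MazurRubin2004, Thm. 5.2.12 and App. A Prop. A.2] -/
theorem deepLowerAtThree_of_leaves_of_expStarOmega (hND : nonempty_neronDeRhamDatum) (hSak : SakamotoKolyvaginThree)
    (hGZK : RankEqAnalyticRankLeOne) (hPT : PoitouTateSelmerDuality) (hlev : CarayolLevelEqConductor) :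
    Summit.BirchSwinnertonDyer.BirchSwinnertonDyer.Theses.KimAtThreeKolyvagin.DeepLowerAtThree :=
  deepLowerAtThree_of_leaves_of_definedKatoUniform (definedKatoUniform_of_expStarOmega hω hND) hSak hGZK hPT hlev

/-- **Crux `DeepLowerAtThreeOffKatoStratum` (stmt-BirchSwinnertonDyer-19679) BY NAME** from three leaves,
`nonempty_neronDeRhamDatum` and (C1_ω).  Conditional. [cite: Kim2025RefinedTNC, Thm 1.1] [cite: Sakamoto2024, Thm. 4.4 (1)(2) (p. 926)] -/
theorem deepLowerAtThreeOffKatoStratum_of_leaves_of_expStarOmega (hND : nonempty_neronDeRhamDatum)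
    (hSak : SakamotoKolyvaginThree) (hGZK : RankEqAnalyticRankLeOne) (hPT : PoitouTateSelmerDuality) :
    Summit.BirchSwinnertonDyer.BirchSwinnertonDyer.Theses.KimAtThreeKolyvagin.DeepLowerAtThreeOffKatoStratum :=
  deepLowerAtThreeOffKatoStratum_of_leaves_of_definedKatoUniform (definedKatoUniform_of_expStarOmega hω hND)
    hSak hGZK hPT

/-- ★ **`DeepLowerAtThree ∧ DeepUpperAtThree` (19075 ∧ 19076) BY NAME** from the four leaves, `nonempty_neronDeRhamDatum`
and (C1_ω).  Conditional. [cite: Kim2025RefinedTNC, Thm 1.1] [cite: Sakamoto2024, Thm. 4.4 (1)(2) (p. 926)] [cite: Carayol1986] -/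
theorem deepLower_and_deepUpper_of_leaves_of_expStarOmega (hND : nonempty_neronDeRhamDatum)
    (hSak : SakamotoKolyvaginThree) (hGZK : RankEqAnalyticRankLeOne) (hPT : PoitouTateSelmerDuality)
    (hlev : CarayolLevelEqConductor) :
    Summit.BirchSwinnertonDyer.BirchSwinnertonDyer.Theses.KimAtThreeKolyvagin.DeepLowerAtThree ∧
      Summit.BirchSwinnertonDyer.BirchSwinnertonDyer.Theses.KimAtThreeKolyvagin.DeepUpperAtThree :=
  deepLower_and_deepUpper_of_leaves_of_definedKatoUniform (definedKatoUniform_of_expStarOmega hω hND)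
    hSak hGZK hPT hlev

/-- **Crux `DeepUpperAtThreeOffKatoStratum` (stmt-BirchSwinnertonDyer-19562) BY NAME** from three leaves,
`nonempty_neronDeRhamDatum` and (C1_ω) (w2-c3 g7's `deepUpperAtThreeOffKatoStratum_of_leaves_of_definedKatoUniform`).
Conditional. [cite: Kim2025RefinedTNC, Thm 1.1] [cite: Sakamoto2024, Thm. 4.4 (1)(2) (p. 926)] -/
theorem deepUpperAtThreeOffKatoStratum_of_leaves_of_expStarOmega (hND : nonempty_neronDeRhamDatum)
    (hSak : SakamotoKolyvaginThree) (hGZK : RankEqAnalyticRankLeOne) (hPT : PoitouTateSelmerDuality) :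
    Summit.BirchSwinnertonDyer.BirchSwinnertonDyer.Theses.KimAtThreeKolyvagin.DeepUpperAtThreeOffKatoStratum :=
  KimAtThreeDeepUpperOfDefinedKatoUniform.deepUpperAtThreeOffKatoStratum_of_leaves_of_definedKatoUniform
    (definedKatoUniform_of_expStarOmega hω hND) hSak hGZK hPT

/-- ★★ **The cell's DEEP statement `N11.KimAtThreeDeepPUB` BY NAME** from the four leaves (one conjunction),
`nonempty_neronDeRhamDatum` and (C1_ω).  The residual object of the whole W2 deep statement on this road is now
(C1_ω) = {Prop-1.2.3 binders; `hker`/`hdual` for the DEFINED `exp*_ω`; X1-int_b; Kato's `ZetaBody` family}.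
Conditional; does not discharge the obligation node; nothing booked. [cite: Kim2025RefinedTNC, Thm 1.1]
[cite: Kim2022StructureSelmer, Thm. 1.9 (6), Thm. 3.13] [cite: MazurRubin2004, App. A Prop. A.2, Thm. 4.4.1 and Thm. 5.2.12]
[cite: Sakamoto2024, Thm. 4.4 (p. 926)] [cite: Carayol1986] -/
theorem kimAtThreeDeepPUB_of_leaves_of_expStarOmega (hND : nonempty_neronDeRhamDatum) :
    SakamotoKolyvaginThree ∧ RankEqAnalyticRankLeOne ∧ PoitouTateSelmerDuality ∧ CarayolLevelEqConductor →
      N11.KimAtThreeDeepPUB :=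
  kimAtThreeDeepPUB_of_leaves_of_definedKatoUniform (definedKatoUniform_of_expStarOmega hω hND)

end Bridge

end Summit.BirchSwinnertonDyer.BirchSwinnertonDyer.Theorems.KimAtThreeDeepLowerExpStarOmegaBridge

end
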